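import Summits.CriticalPhenomena.PercolationContinuityZ3.Theorems.PercNearOneGluingNoHeavyQuantSGCTopLowCapacity
import Summits.CriticalPhenomena.PercolationContinuityZ3.Theorems.PercNearOneGluingNoHeavyQuantGateMoveBlobGeneralWitness
import HarnessLib

/-!
# QUANT lane R8, the GRADED-CLOSURE programme (lead g37 RULING V364): G₀ in the relay regime, the SHALLOW product rows —
# the two-layer row `d` of (gated relay) ∗ μ when its depth `T − 2d` in the big factor is below `1` (companion of `…QuantDepthOneRelayRow`)

builds on p205010 (kernel theorem, internal audit signed; external expert review pending)

Support file (`--supports stmt-CriticalPhenomena-4575`), QUANT lane seat prim-quant-census-2 (gen 64), rung R8 of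
`run/shared/lean/prim/quant/LADDER.md`.  Theorems with standard axioms, no sorries, default heartbeats.  Census memo:
`run/shared/lean/prim/quant/prim-quant-census-2-g64/G0-CENSUS-G64.md` §6c.

THE RELAY CASE OF G₀ ON PAPER (memo §6c; `q = 1`, partner `{0: 1−y, 1: y}` — the family on which the depth-0 node died).  With `s := T − 2d` the depth
of the product threshold `d` in the big factor `μ` (target `T`), `F(i) = μ{≤ i}`, `u = y/(1−y)`, the product two-layer row `d` reads
`u·((1−y)F(d) + yF(d−1)) ≤ (1−y)·μ{≥ k} + y·μ{≥ k−1}`, `k = ⌈T + y − d⌉`.  Four cases, each from ≤ 2 rows of `μ` with NO tilts: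
(α) `s ≥ 1`: one top-low-capacity row `(k, d)` — `…QuantDepthOneRelayRow` (`relayConv_twoLayerRow_of_tlcRow`, ✓ p377094);
(β) `1/2 ≤ s < 1` with `k = d + 2`: `(1−y)·TLCR(d+1, d) + y·TLB(d−1)` — **`relayConv_twoLayerRow_shallow_of_rows`** below (the mid `d+1` absorbs at rate
    `usage(d, d+1) ≥ s/(1−s) ≥ 1`, `heavy_le_usage`; the TLB row `d−1` has threshold `T − d + 1 > d + 1`);
(γ/δ) `−1 < s` with `k = d + 1` (in the census: `−y < s ≤ 1 − y`, including the rows whose threshold is a low of the product but not of `μ`): `TLB(d−1)` alone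
    — **`relayConv_twoLayerRow_top_of_tlbRow`** below (its threshold `T − d + 1` exceeds `d`, so its right side sits inside `μ{≥ d+1}`).
The statements fix the layer arithmetic explicitly (`k = d+2`, resp. `k = d+1`, written out) so that no ceiling appears; the user supplies the case.  Together with
(α) this is G₀ for the top-affordability-tight gated relay at `q = 1` for every product row with `d ≥ 1`, up to the edge cells (`k ≥ M`, `T < 1`) — exactly the
product family `relay ⊗ big law` of `not_tlbGateConvClosed`.  Exact check of the three tilt-free certificates: memo §6c.

[this work]; usage / flows: prim-quant-stmt g22, prim-quant-census-2 g63; `heavy_le_usage`: this lane (`…QuantGateMoveBlobGeneralWitness`); the tensor principle: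
prim-quant-arm-2 g38.  Nothing here is cited as a published result.  The gluing rows served [cite: KozmaNitzan2024, Conjecture 3 (p. 15)]; product measure
[cite: Grimmett1999, §1.3 p. 10].
-/

noncomputable section

namespace Summit.CriticalPhenomena.PercolationContinuityZ3.Theorems

namespace Quant

open Finset

namespace LawDec

/-- **(γ/δ) THE TOP ROWS FROM ONE TWO-LAYER ROW.**  `0 < y < 1`, `μ ≥ 0`, `1 ≤ d`, `−1 < T − 2d` (so the two-layer row `d − 1` of `μ` at target `T` has its
threshold `T − d + 1` above `d`).  If `u·μ{≤ d−1} ≤ μ{h ≤ M : T − (d−1) ≤ h}` then the product two-layer row `d` of `(gate δ₁ y) ∗ μ` in the layer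
arithmetic `k = d + 1` holds: `u·((1−y)·Σ_{n ≤ d} μ n + y·Σ_{n ≤ d−1} μ n) ≤ (1−y)·Σ_{n ≤ M}[d+1 ≤ n] μ n + y·Σ_{n ≤ M}[d ≤ n] μ n`. [this work] -/
theorem relayConv_twoLayerRow_top_of_tlbRow (y T : ℝ) (M d : ℕ) (μ : ℕ → ℝ)
    (hy0 : 0 < y) (hy1 : y < 1) (hμ0 : ∀ h, 0 ≤ μ h) (hd : 1 ≤ d) (hs : -1 < T - 2 * (d : ℝ)) (hdM : d < M + 1)
    (hrow : y / (1 - y) * ∑ l ∈ Finset.range d, μ l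
      ≤ ∑ h ∈ Finset.range (M + 1), (if T - ((d : ℝ) - 1) ≤ (h : ℝ) then μ h else 0)) :
    y / (1 - y) * ((1 - y) * ∑ n ∈ Finset.range (d + 1), μ n + y * ∑ n ∈ Finset.range d, μ n)
      ≤ (1 - y) * ∑ n ∈ Finset.range (M + 1), (if d + 1 ≤ n then μ n else 0)
        + y * ∑ n ∈ Finset.range (M + 1), (if d ≤ n then μ n else 0) := by
  classical
  have h1y : 0 < 1 - y := by linarith
  set u : ℝ := y / (1 - y) with hu
  have hu0 : 0 < u := div_pos hy0 h1y
  have huy : u * (1 - y) = y := by rw [hu]; field_simp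
  -- the TLB right side sits inside the giants ≥ d+1
  have hR : ∑ h ∈ Finset.range (M + 1), (if T - ((d : ℝ) - 1) ≤ (h : ℝ) then μ h else 0)
      ≤ ∑ h ∈ Finset.range (M + 1), (if d + 1 ≤ h then μ h else 0) := by
    refine Finset.sum_le_sum fun h _ => ?_
    by_cases hc : T - ((d : ℝ) - 1) ≤ (h : ℝ)
    · have hdh : d + 1 ≤ h := by
        have : (d : ℝ) < h := by linarith
        have : d < h := by exact_mod_cast this
        omega
      rw [if_pos hc, if_pos hdh]
    · rw [if_neg hc]; split_ifs
      · exact hμ0 h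
      · exact le_rfl
  -- Σ[d ≤ n] = μ d + Σ[d+1 ≤ n]
  have hG : ∑ n ∈ Finset.range (M + 1), (if d ≤ n then μ n else 0)
      = μ d + ∑ n ∈ Finset.range (M + 1), (if d + 1 ≤ n then μ n else 0) := by
    have e : ∀ n ∈ Finset.range (M + 1), (if d ≤ n then μ n else 0)
        = (if n = d then μ n else 0) + (if d + 1 ≤ n then μ n else 0) := by
      intro n _
      by_cases h1 : n = d
      · subst h1; simp
      · by_cases h2 : d + 1 ≤ n
        · rw [if_pos (by omega), if_neg h1, if_pos h2, zero_add]
        · rw [if_neg (by omega), if_neg h1, if_neg h2, zero_add]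
    rw [Finset.sum_congr rfl e, Finset.sum_add_distrib, Finset.sum_ite_eq' (Finset.range (M + 1)) d, if_pos (Finset.mem_range.2 hdM)]
  have hA : ∑ n ∈ Finset.range (d + 1), μ n = ∑ n ∈ Finset.range d, μ n + μ d := Finset.sum_range_succ _ _
  rw [hG, hA]
  have hμd : 0 ≤ μ d := hμ0 d
  have key : u * ∑ l ∈ Finset.range d, μ l ≤ ∑ h ∈ Finset.range (M + 1), (if d + 1 ≤ h then μ h else 0) := hrow.trans hR
  -- LHS = u Σ_{<d} + y μ d ;  RHS = Σ[d+1 ≤ ·] + y μ d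
  have hL : u * ((1 - y) * (∑ n ∈ Finset.range d, μ n + μ d) + y * ∑ n ∈ Finset.range d, μ n)
      = u * ∑ n ∈ Finset.range d, μ n + y * μ d := by
    have : u * ((1 - y) * (∑ n ∈ Finset.range d, μ n + μ d) + y * ∑ n ∈ Finset.range d, μ n)
        = (u * (1 - y) + u * y) * ∑ n ∈ Finset.range d, μ n + u * (1 - y) * μ d := by ring
    rw [this, huy]
    have e2 : y + u * y = u := by rw [hu]; field_simp; ring
    rw [e2]
  rw [hL]
  nlinarith [key, hμd]

/-- **(β) THE SHALLOW ROW FROM TWO ROWS.**  `0 < y < 1`, `μ ≥ 0`, `1/2 ≤ T − 2d < 1`, `d + 1 < M` (for `d = 0` the second row is vacuous).  If `μ` satisfies the top-low-capacity row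
`(d+1, d)` at floor `y`, target `T` (`u·μ{≤ d} ≤ μ{d+2..M} + u·Σ_{h ≤ d+1, T < d+h} μ h/usage y T (d+1) d h`) and the two-layer row `d − 1`
(`u·μ{≤ d−1} ≤ μ{h ≤ M : T − (d−1) ≤ h}`), then the product two-layer row `d` of `(gate δ₁ y) ∗ μ` in the layer arithmetic `k = d + 2` holds:
`u·((1−y)·Σ_{n ≤ d} μ n + y·Σ_{n ≤ d−1} μ n) ≤ (1−y)·Σ_{n ≤ M}[d+2 ≤ n] μ n + y·Σ_{n ≤ M}[d+1 ≤ n] μ n`.  Certificate: `(1−y)·`row`(d+1,d) + y·`row`(d−1)`;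
the mid `d+1` absorbs at rate `usage(d, d+1) ≥ (T−2d)/(1−(T−2d)) ≥ 1` (`heavy_le_usage`). [this work] -/
theorem relayConv_twoLayerRow_shallow_of_rows (y T : ℝ) (M d : ℕ) (μ : ℕ → ℝ)
    (hy0 : 0 < y) (hy1 : y < 1) (hμ0 : ∀ h, 0 ≤ μ h) (hs0 : 1 / 2 ≤ T - 2 * (d : ℝ)) (hs1 : T - 2 * (d : ℝ) < 1)
    (hdM : d + 1 < M)
    (hrow1 : y / (1 - y) * ∑ l ∈ Finset.range (d + 1), μ l
      ≤ ∑ h ∈ Finset.range (M + 1), (if d + 1 + 1 ≤ h then μ h else 0)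
        + y / (1 - y) * ∑ h ∈ Finset.range (M + 1),
            (if h ≤ d + 1 ∧ T < (d : ℝ) + h then μ h / usage y T (d + 1) d h else 0))
    (hrow2 : y / (1 - y) * ∑ l ∈ Finset.range d, μ l
      ≤ ∑ h ∈ Finset.range (M + 1), (if T - ((d : ℝ) - 1) ≤ (h : ℝ) then μ h else 0)) :
    y / (1 - y) * ((1 - y) * ∑ n ∈ Finset.range (d + 1), μ n + y * ∑ n ∈ Finset.range d, μ n)
      ≤ (1 - y) * ∑ n ∈ Finset.range (M + 1), (if d + 2 ≤ n then μ n else 0)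
        + y * ∑ n ∈ Finset.range (M + 1), (if d + 1 ≤ n then μ n else 0) := by
  classical
  have h1y : 0 < 1 - y := by linarith
  set u : ℝ := y / (1 - y) with hu
  have hu0 : 0 < u := div_pos hy0 h1y
  have huy : u * (1 - y) = y := by rw [hu]; field_simp
  have hlow : 2 * (d : ℝ) < T := by linarith
  have hdM' : d + 1 < M + 1 := by omega
  -- (1) the TLB row d-1: its right side sits inside the giants ≥ d+2 (threshold T - d + 1 > d + 1)
  have hR2 : ∑ h ∈ Finset.range (M + 1), (if T - ((d : ℝ) - 1) ≤ (h : ℝ) then μ h else 0)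
      ≤ ∑ h ∈ Finset.range (M + 1), (if d + 2 ≤ h then μ h else 0) := by
    refine Finset.sum_le_sum fun h _ => ?_
    by_cases hc : T - ((d : ℝ) - 1) ≤ (h : ℝ)
    · have hdh : d + 2 ≤ h := by
        have : (d : ℝ) + 1 < h := by linarith
        have : d + 1 < h := by exact_mod_cast this
        omega
      rw [if_pos hc, if_pos hdh]
    · rw [if_neg hc]; split_ifs
      · exact hμ0 h
      · exact le_rfl
  -- (2) the capacity sum of the TLCR row (d+1, d) is the single term h = d+1
  have hcap : ∑ h ∈ Finset.range (M + 1), (if h ≤ d + 1 ∧ T < (d : ℝ) + h then μ h / usage y T (d + 1) d h else 0)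
      = μ (d + 1) / usage y T (d + 1) d (d + 1) := by
    have e : ∀ h ∈ Finset.range (M + 1), (if h ≤ d + 1 ∧ T < (d : ℝ) + h then μ h / usage y T (d + 1) d h else 0)
        = (if h = d + 1 then μ h / usage y T (d + 1) d h else 0) := by
      intro h _
      by_cases h1 : h = d + 1
      · subst h1
        have hc : T < (d : ℝ) + ((d + 1 : ℕ) : ℝ) := by push_cast; linarith
        rw [if_pos ⟨le_rfl, hc⟩, if_pos rfl]
      · rw [if_neg h1, if_neg]
        rintro ⟨hle, hc⟩
        have hle' : h ≤ d := by omega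
        have : (h : ℝ) ≤ d := by exact_mod_cast hle'
        linarith
    rw [Finset.sum_congr rfl e, Finset.sum_ite_eq' (Finset.range (M + 1)) (d + 1), if_pos (Finset.mem_range.2 hdM')]
  -- (3) usage(d, d+1) ≥ heavy rate = (T-2d)/(1-(T-2d)) ≥ 1
  have hcomp : T < (d : ℝ) + ((d + 1 : ℕ) : ℝ) := by push_cast; linarith
  have hus : 1 ≤ usage y T (d + 1) d (d + 1) := by
    refine le_trans ?_ (heavy_le_usage y T (d + 1) d (d + 1) hy0 hy1 le_rfl hlow hcomp)
    have hden : 0 < (d : ℝ) + ((d + 1 : ℕ) : ℝ) - T := by linarith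
    rw [le_div_iff₀ hden]; push_cast; linarith
  have hμd1 : 0 ≤ μ (d + 1) := hμ0 (d + 1)
  have hμd : 0 ≤ μ d := hμ0 d
  have hT : u * (μ (d + 1) / usage y T (d + 1) d (d + 1)) ≤ u * μ (d + 1) := by
    refine mul_le_mul_of_nonneg_left ?_ hu0.le
    exact div_le_self hμd1 hus
  -- (4) bookkeeping
  have hG1 : ∑ n ∈ Finset.range (M + 1), (if d + 1 ≤ n then μ n else 0)
      = μ (d + 1) + ∑ n ∈ Finset.range (M + 1), (if d + 2 ≤ n then μ n else 0) := by
    have e : ∀ n ∈ Finset.range (M + 1), (if d + 1 ≤ n then μ n else 0)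
        = (if n = d + 1 then μ n else 0) + (if d + 2 ≤ n then μ n else 0) := by
      intro n _
      by_cases h1 : n = d + 1
      · subst h1; rw [if_pos le_rfl, if_pos rfl, if_neg (by omega), add_zero]
      · by_cases h2 : d + 2 ≤ n
        · rw [if_pos (by omega), if_neg h1, if_pos h2, zero_add]
        · rw [if_neg (by omega), if_neg h1, if_neg h2, zero_add]
    rw [Finset.sum_congr rfl e, Finset.sum_add_distrib, Finset.sum_ite_eq' (Finset.range (M + 1)) (d + 1),
      if_pos (Finset.mem_range.2 hdM')]
  have hA : ∑ n ∈ Finset.range (d + 1), μ n = ∑ n ∈ Finset.range d, μ n + μ d := Finset.sum_range_succ _ _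
  rw [hcap, hA] at hrow1
  rw [show (d + 1 + 1) = d + 2 from rfl] at hrow1
  rw [hG1, hA]
  -- combine: (1-y)·row1 + y·row2
  have c1 := mul_le_mul_of_nonneg_left hrow1 h1y.le
  have c2 := mul_le_mul_of_nonneg_left (hrow2.trans hR2) hy0.le
  have hL : u * ((1 - y) * (∑ n ∈ Finset.range d, μ n + μ d) + y * ∑ n ∈ Finset.range d, μ n)
      = (1 - y) * (u * (∑ n ∈ Finset.range d, μ n + μ d)) + y * (u * ∑ n ∈ Finset.range d, μ n) := by ring
  rw [hL]
  nlinarith [c1, c2, hT, huy, mul_nonneg hy0.le hμd1, mul_nonneg h1y.le (mul_nonneg hu0.le (div_nonneg hμd1 (le_trans zero_le_one hus)))]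

/-! ## Appendix (same seat, same session): interior gate `g ≥ y` for the shallow rows -/

/-- **(γ/δ), interior gate.**  As `relayConv_twoLayerRow_top_of_tlbRow` for the partner `{0: 1−g, 1: g}`, any `g ≥ y`: the same single two-layer row
`d − 1` of `μ` suffices (the extra term `u(1−g)·μ d` is at most `g·μ d` because `u(1−g) ≤ u(1−y) = y ≤ g`). [this work] -/
theorem gateRelayConv_twoLayerRow_top_of_tlbRow (y g T : ℝ) (M d : ℕ) (μ : ℕ → ℝ)
    (hy0 : 0 < y) (hy1 : y < 1) (hgy : y ≤ g) (hμ0 : ∀ h, 0 ≤ μ h) (hd : 1 ≤ d) (hs : -1 < T - 2 * (d : ℝ))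
    (hdM : d < M + 1)
    (hrow : y / (1 - y) * ∑ l ∈ Finset.range d, μ l
      ≤ ∑ h ∈ Finset.range (M + 1), (if T - ((d : ℝ) - 1) ≤ (h : ℝ) then μ h else 0)) :
    y / (1 - y) * ((1 - g) * ∑ n ∈ Finset.range (d + 1), μ n + g * ∑ n ∈ Finset.range d, μ n)
      ≤ (1 - g) * ∑ n ∈ Finset.range (M + 1), (if d + 1 ≤ n then μ n else 0)
        + g * ∑ n ∈ Finset.range (M + 1), (if d ≤ n then μ n else 0) := by
  classical
  have h1y : 0 < 1 - y := by linarith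
  set u : ℝ := y / (1 - y) with hu
  have hu0 : 0 < u := div_pos hy0 h1y
  have huy : u * (1 - y) = y := by rw [hu]; field_simp
  have hR : ∑ h ∈ Finset.range (M + 1), (if T - ((d : ℝ) - 1) ≤ (h : ℝ) then μ h else 0)
      ≤ ∑ h ∈ Finset.range (M + 1), (if d + 1 ≤ h then μ h else 0) := by
    refine Finset.sum_le_sum fun h _ => ?_
    by_cases hc : T - ((d : ℝ) - 1) ≤ (h : ℝ)
    · have hdh : d + 1 ≤ h := by
        have : (d : ℝ) < h := by linarith
        have : d < h := by exact_mod_cast this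
        omega
      rw [if_pos hc, if_pos hdh]
    · rw [if_neg hc]; split_ifs
      · exact hμ0 h
      · exact le_rfl
  have hG : ∑ n ∈ Finset.range (M + 1), (if d ≤ n then μ n else 0)
      = μ d + ∑ n ∈ Finset.range (M + 1), (if d + 1 ≤ n then μ n else 0) := by
    have e : ∀ n ∈ Finset.range (M + 1), (if d ≤ n then μ n else 0)
        = (if n = d then μ n else 0) + (if d + 1 ≤ n then μ n else 0) := by
      intro n _
      by_cases h1 : n = d
      · subst h1; simp
      · by_cases h2 : d + 1 ≤ n
        · rw [if_pos (by omega), if_neg h1, if_pos h2, zero_add]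
        · rw [if_neg (by omega), if_neg h1, if_neg h2, zero_add]
    rw [Finset.sum_congr rfl e, Finset.sum_add_distrib, Finset.sum_ite_eq' (Finset.range (M + 1)) d, if_pos (Finset.mem_range.2 hdM)]
  have hA : ∑ n ∈ Finset.range (d + 1), μ n = ∑ n ∈ Finset.range d, μ n + μ d := Finset.sum_range_succ _ _
  rw [hG, hA]
  have hμd : 0 ≤ μ d := hμ0 d
  have key : u * ∑ l ∈ Finset.range d, μ l ≤ ∑ h ∈ Finset.range (M + 1), (if d + 1 ≤ h then μ h else 0) := hrow.trans hR
  have hG0 : 0 ≤ ∑ h ∈ Finset.range (M + 1), (if d + 1 ≤ h then μ h else 0) :=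
    Finset.sum_nonneg fun h _ => by split_ifs; exacts [hμ0 h, le_rfl]
  have hL : u * ((1 - g) * (∑ n ∈ Finset.range d, μ n + μ d) + g * ∑ n ∈ Finset.range d, μ n)
      = u * ∑ n ∈ Finset.range d, μ n + u * (1 - g) * μ d := by ring
  rw [hL]
  -- u(1-g) ≤ y ≤ g
  have hug : u * (1 - g) ≤ g := by
    have : u * (1 - g) ≤ u * (1 - y) := mul_le_mul_of_nonneg_left (by linarith) hu0.le
    linarith
  nlinarith [key, hμd, mul_le_mul_of_nonneg_right hug hμd, hG0, hgy]

/-- **(β), interior gate.**  As `relayConv_twoLayerRow_shallow_of_rows` for the partner `{0: 1−g, 1: g}`, `y ≤ g ≤ 1`, in the layer arithmetic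
`k = d + 2`: certificate `(1−g)·`row`(d+1, d) + g·`row`(d−1)`, valid as soon as the mid `d+1` absorbs at rate `usage(d, d+1) ≥ u(1−g)/g`, which the
hypothesis `1/2 ≤ T − 2d` guarantees (heavy rate `≥ 1 ≥ u(1−y)/y ≥ u(1−g)/g`). [this work] -/
theorem gateRelayConv_twoLayerRow_shallow_of_rows (y g T : ℝ) (M d : ℕ) (μ : ℕ → ℝ)
    (hy0 : 0 < y) (hy1 : y < 1) (hgy : y ≤ g) (hg1 : g ≤ 1) (hμ0 : ∀ h, 0 ≤ μ h) (hs0 : 1 / 2 ≤ T - 2 * (d : ℝ))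
    (hs1 : T - 2 * (d : ℝ) < 1) (hdM : d + 1 < M)
    (hrow1 : y / (1 - y) * ∑ l ∈ Finset.range (d + 1), μ l
      ≤ ∑ h ∈ Finset.range (M + 1), (if d + 1 + 1 ≤ h then μ h else 0)
        + y / (1 - y) * ∑ h ∈ Finset.range (M + 1),
            (if h ≤ d + 1 ∧ T < (d : ℝ) + h then μ h / usage y T (d + 1) d h else 0))
    (hrow2 : y / (1 - y) * ∑ l ∈ Finset.range d, μ l
      ≤ ∑ h ∈ Finset.range (M + 1), (if T - ((d : ℝ) - 1) ≤ (h : ℝ) then μ h else 0)) :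
    y / (1 - y) * ((1 - g) * ∑ n ∈ Finset.range (d + 1), μ n + g * ∑ n ∈ Finset.range d, μ n)
      ≤ (1 - g) * ∑ n ∈ Finset.range (M + 1), (if d + 2 ≤ n then μ n else 0)
        + g * ∑ n ∈ Finset.range (M + 1), (if d + 1 ≤ n then μ n else 0) := by
  classical
  have h1y : 0 < 1 - y := by linarith
  set u : ℝ := y / (1 - y) with hu
  have hu0 : 0 < u := div_pos hy0 h1y
  have huy : u * (1 - y) = y := by rw [hu]; field_simp
  have hg0 : 0 < g := lt_of_lt_of_le hy0 hgy
  have hlow : 2 * (d : ℝ) < T := by linarith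
  have hdM' : d + 1 < M + 1 := by omega
  have hR2 : ∑ h ∈ Finset.range (M + 1), (if T - ((d : ℝ) - 1) ≤ (h : ℝ) then μ h else 0)
      ≤ ∑ h ∈ Finset.range (M + 1), (if d + 2 ≤ h then μ h else 0) := by
    refine Finset.sum_le_sum fun h _ => ?_
    by_cases hc : T - ((d : ℝ) - 1) ≤ (h : ℝ)
    · have hdh : d + 2 ≤ h := by
        have : (d : ℝ) + 1 < h := by linarith
        have : d + 1 < h := by exact_mod_cast this
        omega
      rw [if_pos hc, if_pos hdh]
    · rw [if_neg hc]; split_ifs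
      · exact hμ0 h
      · exact le_rfl
  have hcap : ∑ h ∈ Finset.range (M + 1), (if h ≤ d + 1 ∧ T < (d : ℝ) + h then μ h / usage y T (d + 1) d h else 0)
      = μ (d + 1) / usage y T (d + 1) d (d + 1) := by
    have e : ∀ h ∈ Finset.range (M + 1), (if h ≤ d + 1 ∧ T < (d : ℝ) + h then μ h / usage y T (d + 1) d h else 0)
        = (if h = d + 1 then μ h / usage y T (d + 1) d h else 0) := by
      intro h _
      by_cases h1 : h = d + 1
      · subst h1
        have hc : T < (d : ℝ) + ((d + 1 : ℕ) : ℝ) := by push_cast; linarith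
        rw [if_pos ⟨le_rfl, hc⟩, if_pos rfl]
      · rw [if_neg h1, if_neg]
        rintro ⟨hle, hc⟩
        have hle' : h ≤ d := by omega
        have : (h : ℝ) ≤ d := by exact_mod_cast hle'
        linarith
    rw [Finset.sum_congr rfl e, Finset.sum_ite_eq' (Finset.range (M + 1)) (d + 1), if_pos (Finset.mem_range.2 hdM')]
  have hcomp : T < (d : ℝ) + ((d + 1 : ℕ) : ℝ) := by push_cast; linarith
  have hus : 1 ≤ usage y T (d + 1) d (d + 1) := by
    refine le_trans ?_ (heavy_le_usage y T (d + 1) d (d + 1) hy0 hy1 le_rfl hlow hcomp)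
    have hden : 0 < (d : ℝ) + ((d + 1 : ℕ) : ℝ) - T := by linarith
    rw [le_div_iff₀ hden]; push_cast; linarith
  have hμd1 : 0 ≤ μ (d + 1) := hμ0 (d + 1)
  have hμd : 0 ≤ μ d := hμ0 d
  -- (1-g) u μ(d+1)/usage ≤ (1-g) u μ(d+1) ≤ g μ(d+1)   (u(1-g) ≤ u(1-y) = y ≤ g)
  have hug : u * (1 - g) ≤ g := by
    have : u * (1 - g) ≤ u * (1 - y) := mul_le_mul_of_nonneg_left (by linarith) hu0.le
    linarith
  have hT : (1 - g) * (u * (μ (d + 1) / usage y T (d + 1) d (d + 1))) ≤ g * μ (d + 1) := by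
    have h1 : μ (d + 1) / usage y T (d + 1) d (d + 1) ≤ μ (d + 1) := div_le_self hμd1 hus
    have h2 : (1 - g) * (u * (μ (d + 1) / usage y T (d + 1) d (d + 1))) ≤ (1 - g) * (u * μ (d + 1)) :=
      mul_le_mul_of_nonneg_left (mul_le_mul_of_nonneg_left h1 hu0.le) (by linarith)
    nlinarith [mul_le_mul_of_nonneg_right hug hμd1]
  have hG1 : ∑ n ∈ Finset.range (M + 1), (if d + 1 ≤ n then μ n else 0)
      = μ (d + 1) + ∑ n ∈ Finset.range (M + 1), (if d + 2 ≤ n then μ n else 0) := by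
    have e : ∀ n ∈ Finset.range (M + 1), (if d + 1 ≤ n then μ n else 0)
        = (if n = d + 1 then μ n else 0) + (if d + 2 ≤ n then μ n else 0) := by
      intro n _
      by_cases h1 : n = d + 1
      · subst h1; rw [if_pos le_rfl, if_pos rfl, if_neg (by omega), add_zero]
      · by_cases h2 : d + 2 ≤ n
        · rw [if_pos (by omega), if_neg h1, if_pos h2, zero_add]
        · rw [if_neg (by omega), if_neg h1, if_neg h2, zero_add]
    rw [Finset.sum_congr rfl e, Finset.sum_add_distrib, Finset.sum_ite_eq' (Finset.range (M + 1)) (d + 1),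
      if_pos (Finset.mem_range.2 hdM')]
  have hA : ∑ n ∈ Finset.range (d + 1), μ n = ∑ n ∈ Finset.range d, μ n + μ d := Finset.sum_range_succ _ _
  rw [hcap, hA] at hrow1
  rw [show (d + 1 + 1) = d + 2 from rfl] at hrow1
  rw [hG1, hA]
  have c1 := mul_le_mul_of_nonneg_left hrow1 (show (0 : ℝ) ≤ 1 - g by linarith)
  have c2 := mul_le_mul_of_nonneg_left (hrow2.trans hR2) hg0.le
  have hL : u * ((1 - g) * (∑ n ∈ Finset.range d, μ n + μ d) + g * ∑ n ∈ Finset.range d, μ n)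
      = (1 - g) * (u * (∑ n ∈ Finset.range d, μ n + μ d)) + g * (u * ∑ n ∈ Finset.range d, μ n) := by ring
  rw [hL]
  nlinarith [c1, c2, hT]

end LawDec

end Quant

end Summit.CriticalPhenomena.PercolationContinuityZ3.Theorems
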